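import Mathlib
import Literature.NumberTheory.Automorphic.ReciprocityGLnDescentProofs
import Literature.NumberTheory.Automorphic.TunnellOctahedralGlobal
import Literature.NumberTheory.GaloisRepresentations.FrobeniusDensityTheorem
import Literature.NumberTheory.GaloisRepresentations.FrobeniusPlaces
import Literature.NumberTheory.GaloisRepresentations.ToLocalRestrictField
import Literature.NumberTheory.PAdicHodge.DeRhamBaseChange
import HarnessLib

/-!
# DeRhamDescent

Topic `Literature/NumberTheory/PAdicHodge`. Named literature fact(s) relocated by the gate from `Summits/Langlands/Langlands/Theorems/EisensteinDegreeShiftSolubleDescentGLnPosition.lean`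
(accept-time relocation of `[cite]`d propositions written inline in a Summits proposal; human ruling 2026-08-15).
Sources: BrinonConrad2009.

* `Literature.NumberTheory.PAdicHodge.DeRhamDescent`
-/

namespace Literature.NumberTheory.PAdicHodge

open scoped NumberField MatrixGroups
open Filter IsDedekindDomain Field NumberField ValuativeRel
open Literature.NumberTheory.Automorphic Literature.NumberTheory.GaloisRepresentations

/-- **The de Rham property descends along a finite extension of the base field** (Brinon–Conrad 2009,
Prop. 6.3.8, p. 80: "For any complete discretely-valued extension `K'/K` inside of `C_K` and any
`V ∈ Rep_{ℚ_p}(G_K)`, the natural map `K' ⊗_K D_{dR,K}(V) → D_{dR,K'}(V)` is an isomorphism … In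
particular, `V` is de Rham as a `G_K`-representation if and only if `V` is de Rham as a
`G_{K'}`-representation"; Fontaine 1994, Exp. III §1.5, §3), tree form for THE pinned data, the
CONVERSE half of `Literature.NumberTheory.PAdicHodge.DeRhamBaseChange` with the same binders: for a
continuous embedding `K → L` of characteristic-`0` non-archimedean local fields of residue
characteristic `ℓ` (`hK : |ℓ|_K < 1`, `hL : |ℓ|_L < 1`; both are then finite over `ℚ_ℓ`, so `L/K` is
finite) and a framed `ρ : Γ_K →ₜ* GL_n(ℚ̄_ℓ)` whose restriction `ρ ∘ absGaloisRestrict K L : Γ_L →ₜ*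
GL_n(ℚ̄_ℓ)` is de Rham for `fontainePst L ℓ hL`, the representation `ρ` is de Rham for
`fontainePst K ℓ hK`.  Named fact (D-0014); discharging it is Prop. 6.3.8 together with the transport
of the tree's `B_dR(L)` to `B_dR(K)` along `\widehat{K̄} ≅ \widehat{L̄}`, exactly as for the ascent half.
-- TODO(general form): `K' ⊗_K D_{dR,K}(V) ≅ D_{dR,K'}(V)` in `Fil_{K'}` for every complete discretely-valued `K'/K ⊆ C_K`.
[cite: BrinonConrad2009, Prop. 6.3.8] [file NumberTheory/PAdicHodge/DeRhamDescent] -/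
def DeRhamDescent : Prop :=
  ∀ (K L : Type) [Field K] [ValuativeRel K] [TopologicalSpace K] [IsNonarchimedeanLocalField K]
    [CharZero K] [Field L] [ValuativeRel L] [TopologicalSpace L] [IsNonarchimedeanLocalField L]
    [CharZero L] [Algebra K L], Continuous (algebraMap K L) →
    ∀ (ℓ : ℕ) [Fact ℓ.Prime] (hK : valuation K (ℓ : K) < 1) (hL : valuation L (ℓ : L) < 1) (n : ℕ)
      (ρ : FramedRep (absoluteGaloisGroup K) (PadicAlgCl ℓ) n),
      (fontainePst L ℓ hL).IsDeRhamFramed (ρ.comp (absGaloisRestrict K L)) →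
        (fontainePst K ℓ hK).IsDeRhamFramed ρ

/-! ## Global plumbing: de Rham-ness of the pinned data descends along `E/F`, place by place -/

end Literature.NumberTheory.PAdicHodge
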